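import Summits.AtomisticToContinuum.Crystallization.Theorems.ChargedEnergyGapExposureDial
import Summits.AtomisticToContinuum.Crystallization.Theorems.FrustratedLawDichotomyPeriodicSupercell

/-!
# `PricedLinkCensus.ChargedEnergyGap` (stmt-AtomisticToContinuum-14231) — presentation calculus for the priced species
# (decomp-a2c lens 3, generation 44; part F-A = groundwork of the deep-rigidity split, part F-B `ChargedEnergyGapDeepRigidity`)

A periodic point set has many presentations `(Λ, F)`; the pricings of parts D/E count SPECIES OF MOTIF SITES per presentation.  This
file proves the two facts that let a pricing be moved from one presentation to another:

§1  SYSTEMS OF REPRESENTATIVES (adapted from the tree's `LjBilayerHcpSketch.presentation_*`, proof of the presentation invariance of the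
    energy per particle, here for an ARBITRARY invariant function; that module is outside the farm build, so the four lemmas are re-proved):
    ★ `card_mul_sum_motif_eq_of_points_eq` — if `P.points = Q.points` then `#F_Q · Σ_{F_P} f = #F_P · Σ_{F_Q} f` for every `f` invariant
    under both lattices; ★ `card_mul_natCard_motif_eq_of_points_eq` — the same for the COUNT of motif sites satisfying an invariant predicate.
    `IsSupercell k Q P` (same point set, periods = the `k`-fold multiples; exists with equal energy per particle for every `k ≥ 1`, the
    tree's `FrustratedLawDichotomyPeriodicSupercell.exists_supercell_points_energy`).
§2  THE COMPACT GROSS CHARGED SPECIES READ AT A POINT OF SPACE, `CompactGrossAt θ ε R Q p` (charged, not `θ`-charted, not exposed), agrees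
    with the species of parts D/E at motif sites (`compactGrossAt_coe_iff`), is invariant under the periods of `Q`
    (★ `compactGrossAt_add_period`: charge, own scale, first shell, chart, site energy, field, holes, exposure are all period-invariant) and
    only reads the point set (★ `compactGrossAt_congr_points`).

No new pieces here; all `[folklore]` bookkeeping about the Blanc–Lewin periodic energy [BlancLewin2015 §2.1 (23)].
-/

noncomputable section

open scoped Classical
open Literature.MathematicalPhysics.StatisticalMechanics
open Literature.Geometry.DiscreteGeometry
open Summit.AtomisticToContinuum.Crystallization.Theses.PricedLinkCensus
open Summit.AtomisticToContinuum.Crystallization.Theorems.ChargedEnergyGapNegative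
open Summit.AtomisticToContinuum.Crystallization.Theorems.FrustratedLawDichotomyPeriodicSupercell

namespace Summit.AtomisticToContinuum.Crystallization.Theorems.ChargedEnergyGapChartDial

/-! ## §1 Systems of representatives; proportional motif sums and counts; supercells -/

/-- A period of a periodic configuration is a period of its point set. -/
theorem add_mem_points_iff (Q : PeriodicConfiguration 3) {g : E3} (hg : g ∈ Q.lattice) (q : E3) :
    q + g ∈ Q.points ↔ q ∈ Q.points :=
  ⟨fun h => by simpa using Q.add_mem_points h (Q.lattice.neg_mem hg), fun h => Q.add_mem_points h hg⟩

/-- Two finite systems of representatives of a set `S` modulo a subgroup `M` have the same cardinality and carry the same sum of any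
`M`-invariant function. [folklore; tree `LjBilayerHcpSketch.presentation_repSystems_sum_eq`] -/
theorem pres_repSystems_sum_eq {ι ι' : Type*} {M : Submodule ℤ E3} {S : Set E3} {I : Finset ι} {I' : Finset ι'}
    (p : ι → E3) (p' : ι' → E3) {f : E3 → ℝ} (hf : ∀ a b, a - b ∈ M → f a = f b)
    (hI : ∀ i ∈ I, p i ∈ S) (hIc : ∀ z ∈ S, ∃ i ∈ I, z - p i ∈ M) (hIs : ∀ i ∈ I, ∀ j ∈ I, p i - p j ∈ M → i = j)
    (hI' : ∀ i ∈ I', p' i ∈ S) (hI'c : ∀ z ∈ S, ∃ i ∈ I', z - p' i ∈ M)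
    (hI's : ∀ i ∈ I', ∀ j ∈ I', p' i - p' j ∈ M → i = j) :
    I.card = I'.card ∧ ∑ i ∈ I, f (p i) = ∑ i ∈ I', f (p' i) := by
  choose φ hφ hφm using fun i (hi : i ∈ I) => hI'c (p i) (hI i hi)
  choose ψ hψ hψm using fun i (hi : i ∈ I') => hIc (p' i) (hI' i hi)
  have left : ∀ i hi, ψ (φ i hi) (hφ i hi) = i := fun i hi => by
    refine hIs _ (hψ _ _) i hi ?_
    have h1 := M.add_mem (hφm i hi) (hψm (φ i hi) (hφ i hi))
    rw [sub_add_sub_cancel] at h1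
    exact sub_mem_comm_iff.1 h1
  have right : ∀ i hi, φ (ψ i hi) (hψ i hi) = i := fun i hi => by
    refine hI's _ (hφ _ _) i hi ?_
    have h1 := M.add_mem (hψm i hi) (hφm (ψ i hi) (hψ i hi))
    rw [sub_add_sub_cancel] at h1
    exact sub_mem_comm_iff.1 h1
  exact ⟨Finset.card_bij' φ ψ hφ hψ left right, Finset.sum_bij' φ ψ hφ hψ left right fun i hi => hf _ _ (hφm i hi)⟩

/-- `F × R → F + Λ`, `(x, r) ↦ x + r`, is a system of representatives of the point set modulo `M ≤ Λ` whenever `R ⊂ Λ` is one of `Λ`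
modulo `M`. [folklore; tree `LjBilayerHcpSketch.presentation_prod_repSystem`] -/
theorem pres_prod_repSystem (P : PeriodicConfiguration 3) {M : Submodule ℤ E3} (hM : M ≤ P.lattice) {R : Finset E3}
    (hR : ∀ r ∈ R, r ∈ P.lattice) (hRc : ∀ g ∈ P.lattice, ∃ r ∈ R, g - r ∈ M)
    (hRs : ∀ r ∈ R, ∀ r' ∈ R, r - r' ∈ M → r = r') :
    (∀ q ∈ P.motif ×ˢ R, q.1 + q.2 ∈ P.points) ∧ (∀ z ∈ P.points, ∃ q ∈ P.motif ×ˢ R, z - (q.1 + q.2) ∈ M) ∧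
    (∀ q ∈ P.motif ×ˢ R, ∀ q' ∈ P.motif ×ˢ R, (q.1 + q.2) - (q'.1 + q'.2) ∈ M → q = q') := by
  refine ⟨fun q hq => ?_, fun z hz => ?_, fun q hq q' hq' hqq' => ?_⟩
  · rw [Finset.mem_product] at hq
    exact P.add_mem_points (P.mem_points_of_mem_motif hq.1) (hR _ hq.2)
  · obtain ⟨x, hx, g, hg, rfl⟩ := hz
    obtain ⟨r, hr, hgr⟩ := hRc g hg
    exact ⟨(x, r), Finset.mem_product.2 ⟨hx, hr⟩, by rwa [add_sub_add_left_eq_sub]⟩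
  · rw [Finset.mem_product] at hq hq'
    have h1 : q.1 - q'.1 ∈ P.lattice := by
      have h2 : q.1 - q'.1 = (q.1 + q.2 - (q'.1 + q'.2)) - (q.2 - q'.2) := by abel
      rw [h2]
      exact P.lattice.sub_mem (hM hqq') (P.lattice.sub_mem (hR _ hq.2) (hR _ hq'.2))
    have h3 : q.1 = q'.1 := P.eq_of_sub_mem _ hq.1 _ hq'.1 h1
    rw [h3, add_sub_add_left_eq_sub] at hqq'
    exact Prod.ext h3 (hRs _ hq.2 _ hq'.2 hqq')

/-- The sum of a `Λ`-invariant function over `F + R` (`R ⊂ Λ` finite) is `#R` times its sum over `F`.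
[folklore; tree `LjBilayerHcpSketch.presentation_sum_prod`] -/
theorem pres_sum_prod (P : PeriodicConfiguration 3) {R : Finset E3} (hR : ∀ r ∈ R, r ∈ P.lattice) {f : E3 → ℝ}
    (hf : ∀ x, ∀ g ∈ P.lattice, f (x + g) = f x) :
    ∑ q ∈ P.motif ×ˢ R, f (q.1 + q.2) = R.card * ∑ x ∈ P.motif, f x := by
  rw [Finset.sum_product, Finset.mul_sum]
  refine Finset.sum_congr rfl fun x _ => ?_
  rw [Finset.sum_congr rfl fun r hr => hf x r (hR r hr), Finset.sum_const, nsmul_eq_mul]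

/-- **Finite index**: if `F + Λ = F' + Λ'` as point sets, `Λ` has a finite system of representatives modulo `Λ ⊓ Λ'`.
[folklore; tree `LjBilayerHcpSketch.presentation_exists_reps`] -/
theorem pres_exists_reps (P Q : PeriodicConfiguration 3) (h : P.points = Q.points) :
    ∃ R : Finset E3, (∀ r ∈ R, r ∈ P.lattice) ∧ (∀ g ∈ P.lattice, ∃ r ∈ R, g - r ∈ P.lattice ⊓ Q.lattice) ∧
      (∀ r ∈ R, ∀ r' ∈ R, r - r' ∈ P.lattice ⊓ Q.lattice → r = r') := by
  obtain ⟨x₀, hx₀⟩ := Q.motif_nonempty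
  have key : ∀ g ∈ P.lattice, ∃ y ∈ Q.motif, x₀ + g - y ∈ Q.lattice := fun g hg => by
    refine Q.exists_sub_mem_lattice ?_
    rw [← h]
    exact P.add_mem_points (h ▸ Q.mem_points_of_mem_motif hx₀) hg
  have hex : ∀ y : E3, (∃ g ∈ P.lattice, x₀ + g - y ∈ Q.lattice) → ∃ g, g ∈ P.lattice ∧ x₀ + g - y ∈ Q.lattice :=
    fun y ⟨g, hg, hgy⟩ => ⟨g, hg, hgy⟩
  choose! σ hσP hσQ using hex
  refine ⟨(Q.motif.filter fun y => ∃ g ∈ P.lattice, x₀ + g - y ∈ Q.lattice).image σ, ?_, fun g hg => ?_, ?_⟩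
  · intro r hr
    obtain ⟨y, hy, rfl⟩ := Finset.mem_image.1 hr
    exact hσP y (Finset.mem_filter.1 hy).2
  · obtain ⟨y, hy, hgy⟩ := key g hg
    have hPy : ∃ g ∈ P.lattice, x₀ + g - y ∈ Q.lattice := ⟨g, hg, hgy⟩
    refine ⟨σ y, Finset.mem_image.2 ⟨y, Finset.mem_filter.2 ⟨hy, hPy⟩, rfl⟩,
      Submodule.mem_inf.2 ⟨P.lattice.sub_mem hg (hσP y hPy), ?_⟩⟩
    have h1 := Q.lattice.sub_mem hgy (hσQ y hPy)
    rwa [show x₀ + g - y - (x₀ + σ y - y) = g - σ y by abel] at h1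
  · intro r hr r' hr' hrr'
    obtain ⟨y, hy, rfl⟩ := Finset.mem_image.1 hr
    obtain ⟨y', hy', rfl⟩ := Finset.mem_image.1 hr'
    obtain ⟨hy, hPy⟩ := Finset.mem_filter.1 hy
    obtain ⟨hy', hPy'⟩ := Finset.mem_filter.1 hy'
    have h1 : y - y' ∈ Q.lattice := by
      have h2 := Q.lattice.add_mem (Q.lattice.sub_mem (Submodule.mem_inf.1 hrr').2 (hσQ y hPy)) (hσQ y' hPy')
      rwa [show σ y - σ y' - (x₀ + σ y - y) + (x₀ + σ y' - y') = y - y' by abel] at h2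
    rw [Q.eq_of_sub_mem y hy y' hy' h1]

/-- ★ **Motif sums are proportional across presentations.**  If `P.points = Q.points` then for every `f` invariant under both lattices
of periods `#F_Q · Σ_{F_P} f = #F_P · Σ_{F_Q} f` (both are `#F_P · #F_Q ·` the average of `f` over the classes modulo `Λ_P ⊓ Λ_Q`). -/
theorem card_mul_sum_motif_eq_of_points_eq (P Q : PeriodicConfiguration 3) (h : P.points = Q.points) {f : E3 → ℝ}
    (hfP : ∀ x, ∀ g ∈ P.lattice, f (x + g) = f x) (hfQ : ∀ x, ∀ g ∈ Q.lattice, f (x + g) = f x) :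
    (Q.motif.card : ℝ) * ∑ x ∈ P.motif, f x = (P.motif.card : ℝ) * ∑ x ∈ Q.motif, f x := by
  set M : Submodule ℤ E3 := P.lattice ⊓ Q.lattice with hM
  have hfM : ∀ a b, a - b ∈ M → f a = f b := fun a b hab => by
    have h1 := hfP b (a - b) (Submodule.mem_inf.1 hab).1
    rwa [add_sub_cancel] at h1
  obtain ⟨R, hRL, hRc, hRs⟩ := pres_exists_reps P Q h
  obtain ⟨R', hR'L, hR'c, hR's⟩ := pres_exists_reps Q P h.symm
  have hMQ : Q.lattice ⊓ P.lattice = M := inf_comm _ _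
  rw [hMQ] at hR'c hR's
  obtain ⟨hA, hAc, hAs⟩ := pres_prod_repSystem P inf_le_left hRL hRc hRs
  obtain ⟨hA', hA'c, hA's⟩ := pres_prod_repSystem Q inf_le_right hR'L hR'c hR's
  rw [← h] at hA' hA'c
  obtain ⟨hcard, hsum⟩ := pres_repSystems_sum_eq (M := M) (S := P.points) (I := P.motif ×ˢ R) (I' := Q.motif ×ˢ R')
    (fun q : E3 × E3 => q.1 + q.2) (fun q : E3 × E3 => q.1 + q.2) hfM hA hAc hAs hA' hA'c hA's
  rw [Finset.card_product, Finset.card_product] at hcard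
  rw [pres_sum_prod P hRL hfP, pres_sum_prod Q hR'L hfQ] at hsum
  have hR0 : R.Nonempty := by
    obtain ⟨r, hr, -⟩ := hRc 0 P.lattice.zero_mem
    exact ⟨r, hr⟩
  have hr : (R.card : ℝ) ≠ 0 := by exact_mod_cast (Finset.card_pos.2 hR0).ne'
  have hcard' : (P.motif.card : ℝ) * R.card = Q.motif.card * R'.card := by exact_mod_cast hcard
  refine mul_left_cancel₀ hr ?_
  linear_combination (Q.motif.card : ℝ) * hsum - (∑ x ∈ Q.motif, f x) * hcard'

/-- A motif-site count as a motif sum of an indicator. -/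
theorem natCard_motif_eq_sum (Q : PeriodicConfiguration 3) (S : E3 → Prop) :
    (Nat.card {x : Q.motif // S x} : ℝ) = ∑ x ∈ Q.motif, if S x then (1 : ℝ) else 0 := by
  rw [Finset.sum_boole]
  congr 1
  rw [← Nat.card_eq_finsetCard]
  exact Nat.card_congr ((Equiv.subtypeSubtypeEquivSubtypeInter (fun x => x ∈ Q.motif) S).trans
    (Equiv.subtypeEquivRight fun x => by rw [Finset.mem_filter]))

/-- ★ **Motif counts are proportional across presentations**: for a predicate `S` on space invariant under both lattices of periods,
`#F_Q · #{x' ∈ F_P : S x'} = #F_P · #{x ∈ F_Q : S x}`. -/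
theorem card_mul_natCard_motif_eq_of_points_eq (P Q : PeriodicConfiguration 3) (h : P.points = Q.points) {S : E3 → Prop}
    (hSP : ∀ x, ∀ g ∈ P.lattice, (S (x + g) ↔ S x)) (hSQ : ∀ x, ∀ g ∈ Q.lattice, (S (x + g) ↔ S x)) :
    (Q.motif.card : ℝ) * Nat.card {x : P.motif // S x} = (P.motif.card : ℝ) * Nat.card {x : Q.motif // S x} := by
  rw [natCard_motif_eq_sum P S, natCard_motif_eq_sum Q S]
  exact card_mul_sum_motif_eq_of_points_eq P Q h (f := fun x => if S x then (1 : ℝ) else 0)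
    (fun x g hg => by simp only [hSP x g hg]) (fun x g hg => by simp only [hSQ x g hg])

/-- Presentations with proportional data: `#F_Q · excess P = #F_P · excess Q` when the energies per particle agree. -/
theorem card_mul_excess_eq (P Q : PeriodicConfiguration 3) (hE : P.energyPerParticle lennardJones = Q.energyPerParticle lennardJones) :
    (Q.motif.card : ℝ) * excess P = (P.motif.card : ℝ) * excess Q := by
  simp only [excess, hE]; ring

/-- `P` is a `k`-fold SUPERCELL PRESENTATION of `Q`: the same point set, and the periods of `P` are exactly the `k`-fold multiples of
the periods of `Q`. -/
def IsSupercell (k : ℕ) (Q P : PeriodicConfiguration 3) : Prop :=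
  P.points = Q.points ∧ ∀ g : E3, g ∈ P.lattice ↔ ∃ g₀ ∈ Q.lattice, (k : ℝ) • g₀ = g

/-- Supercell presentations with the same energy per particle exist for every `k ≥ 1` (the tree's `exists_supercell_points_energy`). -/
theorem exists_isSupercell (Q : PeriodicConfiguration 3) {k : ℕ} (hk : 0 < k) :
    ∃ P : PeriodicConfiguration 3, IsSupercell k Q P ∧ P.energyPerParticle lennardJones = Q.energyPerParticle lennardJones := by
  haveI : NeZero k := ⟨hk.ne'⟩
  obtain ⟨P, hP, hE, hL⟩ := exists_supercell_points_energy Q k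
  exact ⟨P, ⟨hP, hL⟩, hE lennardJones⟩

/-- The periods of a supercell presentation are periods of the original presentation. -/
theorem IsSupercell.mem_lattice {k : ℕ} {Q P : PeriodicConfiguration 3} (h : IsSupercell k Q P) {g : E3} (hg : g ∈ P.lattice) :
    g ∈ Q.lattice := by
  obtain ⟨g₀, hg₀, rfl⟩ := (h.2 g).1 hg
  rw [Nat.cast_smul_eq_nsmul ℝ k g₀]
  exact nsmul_mem hg₀ k

/-! ## §2 The compact gross charged species read at a point of space; its two invariances -/

/-- EXPOSED, read at a point of space: `ε`-rattler or within `R` of an `ε`-hole (the site-free form of `Exposed`). -/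
def ExposedAt (ε R : ℝ) (Q : PeriodicConfiguration 3) (p : E3) : Prop :=
  eStar + ε ≤ 2 * siteEnergy Q p ∨ ∃ z : E3, dist p z ≤ R ∧ IsHole ε Q z

/-- `Exposed` is `ExposedAt` at the site (definitional). -/
theorem exposed_iff_exposedAt (ε R : ℝ) (Q : PeriodicConfiguration 3) (x : Q.motif) :
    Exposed ε R Q x ↔ ExposedAt ε R Q (x : E3) := Iff.rfl

/-- COMPACT GROSS CHARGED, read at a point of space: a point of `Q` that is charged (tolerance `1/100`), not `θ`-charted, not exposed. -/
def CompactGrossAt (θ ε R : ℝ) (Q : PeriodicConfiguration 3) (p : E3) : Prop :=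
  ∃ hp : p ∈ Q.points,
    (¬ IsChargeFree (1 / 100) (Subtype.val : Q.points → E3) ⟨p, hp⟩ ∧ ¬ ChartedAt θ Q ⟨p, hp⟩) ∧ ¬ ExposedAt ε R Q p

/-- The compact gross charged species of parts D/E is `CompactGrossAt` at the site. -/
theorem compactGrossAt_coe_iff (θ ε R : ℝ) (Q : PeriodicConfiguration 3) (x : Q.motif) :
    CompactGrossAt θ ε R Q (x : E3) ↔ (Charged Q x ∧ ¬ ChartedAt θ Q (pt Q x)) ∧ ¬ Exposed ε R Q x :=
  ⟨fun ⟨_, h⟩ => h, fun h => ⟨Q.mem_points_of_mem_motif x.2, h⟩⟩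

/-- Charge is invariant under the periods (the tree's `Blocks.isChargeFree_transl`, on anonymous points). -/
theorem isChargeFree_add_period (η : ℝ) (Q : PeriodicConfiguration 3) {g : E3} (hg : g ∈ Q.lattice) {p : E3}
    (hp : p ∈ Q.points) (hpg : p + g ∈ Q.points) :
    IsChargeFree η (Subtype.val : Q.points → E3) ⟨p + g, hpg⟩ ↔ IsChargeFree η (Subtype.val : Q.points → E3) ⟨p, hp⟩ :=
  Blocks.isChargeFree_transl Q η hg ⟨p, hp⟩

/-- The own scale is invariant under the periods (the tree's `Blocks.nearestDist_transl`). -/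
theorem nn_add_period (Q : PeriodicConfiguration 3) {g : E3} (hg : g ∈ Q.lattice) {p : E3} (hp : p ∈ Q.points)
    (hpg : p + g ∈ Q.points) : nn Q ⟨p + g, hpg⟩ = nn Q ⟨p, hp⟩ :=
  Blocks.nearestDist_transl Q hg ⟨p, hp⟩

/-- The recentred rescaled first shell is invariant under the periods. -/
theorem shellSet_add_period (Q : PeriodicConfiguration 3) {g : E3} (hg : g ∈ Q.lattice) {p : E3} (hp : p ∈ Q.points)
    (hpg : p + g ∈ Q.points) : shellSet Q ⟨p + g, hpg⟩ = shellSet Q ⟨p, hp⟩ := by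
  have hnn : nn Q ⟨p + g, hpg⟩ = nn Q ⟨p, hp⟩ := nn_add_period Q hg hp hpg
  ext v
  simp only [shellSet, hnn, Set.mem_image, Set.mem_setOf_eq]
  constructor
  · rintro ⟨q, ⟨hq, hne, hd⟩, rfl⟩
    refine ⟨q - g, ⟨(add_mem_points_iff Q hg (q - g)).1 (by rwa [sub_add_cancel]),
      fun h0 => hne (sub_eq_iff_eq_add.1 h0), ?_⟩, ?_⟩
    · have h1 : dist p (q - g) = dist (p + g) q := by
        rw [dist_eq_norm, dist_eq_norm]; congr 1; abel
      rwa [h1]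
    · congr 1; abel
  · rintro ⟨q, ⟨hq, hne, hd⟩, rfl⟩
    refine ⟨q + g, ⟨Q.add_mem_points hq hg, fun h0 => hne (add_right_cancel h0), ?_⟩, ?_⟩
    · have h1 : dist (p + g) (q + g) = dist p q := dist_add_right _ _ _
      rwa [h1]
    · congr 1; abel

/-- The chart predicate is invariant under the periods. -/
theorem chartedAt_add_period (θ : ℝ) (Q : PeriodicConfiguration 3) {g : E3} (hg : g ∈ Q.lattice) {p : E3} (hp : p ∈ Q.points)
    (hpg : p + g ∈ Q.points) : ChartedAt θ Q ⟨p + g, hpg⟩ ↔ ChartedAt θ Q ⟨p, hp⟩ := by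
  unfold ChartedAt
  rw [shellSet_add_period Q hg hp hpg]

/-- The site energy is invariant under the periods (the tree's `tsum_site_eq_of_sub_mem_lattice`). -/
theorem siteEnergy_add_period (Q : PeriodicConfiguration 3) {g : E3} (hg : g ∈ Q.lattice) (p : E3) :
    siteEnergy Q (p + g) = siteEnergy Q p := by
  unfold siteEnergy
  rw [tsum_site_eq_of_sub_mem_lattice Q lennardJones (x := p) (x' := p + g) (by simpa using hg)]

/-- The field is invariant under the periods. -/
theorem holeField_add_period (Q : PeriodicConfiguration 3) {g : E3} (hg : g ∈ Q.lattice) (z : E3) :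
    holeField Q (z + g) = holeField Q z := by
  unfold holeField
  rw [← Equiv.tsum_eq (Blocks.transl Q hg) (fun q : Q.points => lennardJones (dist (z + g) (q : E3)))]
  refine tsum_congr fun q => ?_
  simp [Blocks.transl, dist_add_right]

/-- Holes are invariant under the periods. -/
theorem isHole_add_period (ε : ℝ) (Q : PeriodicConfiguration 3) {g : E3} (hg : g ∈ Q.lattice) (z : E3) :
    IsHole ε Q (z + g) ↔ IsHole ε Q z := by
  unfold IsHole
  rw [holeField_add_period Q hg z]
  refine and_congr_left' ⟨fun h q hq => ?_, fun h q hq => ?_⟩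
  · have h1 := h (q + g) (Q.add_mem_points hq hg)
    rwa [dist_add_right] at h1
  · have h1 := h (q - g) ((add_mem_points_iff Q hg (q - g)).1 (by rwa [sub_add_cancel]))
    have h2 : dist (z + g) q = dist z (q - g) := by
      rw [dist_eq_norm, dist_eq_norm]; congr 1; abel
    rwa [h2]

/-- Exposure is invariant under the periods. -/
theorem exposedAt_add_period (ε R : ℝ) (Q : PeriodicConfiguration 3) {g : E3} (hg : g ∈ Q.lattice) (p : E3) :
    ExposedAt ε R Q (p + g) ↔ ExposedAt ε R Q p := by
  unfold ExposedAt
  rw [siteEnergy_add_period Q hg p]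
  refine or_congr_right ⟨?_, ?_⟩
  · rintro ⟨z, hd, hz⟩
    refine ⟨z - g, ?_, ?_⟩
    · have h1 : dist p (z - g) = dist (p + g) z := by
        rw [dist_eq_norm, dist_eq_norm]; congr 1; abel
      rwa [h1]
    · rw [← isHole_add_period ε Q hg (z - g), sub_add_cancel]
      exact hz
  · rintro ⟨z, hd, hz⟩
    exact ⟨z + g, by rwa [dist_add_right], (isHole_add_period ε Q hg z).2 hz⟩

/-- ★ The compact gross charged species is invariant under the periods of `Q`. -/
theorem compactGrossAt_add_period (θ ε R : ℝ) (Q : PeriodicConfiguration 3) {g : E3} (hg : g ∈ Q.lattice) (p : E3) :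
    CompactGrossAt θ ε R Q (p + g) ↔ CompactGrossAt θ ε R Q p := by
  unfold CompactGrossAt
  rw [exposedAt_add_period ε R Q hg p]
  constructor
  · rintro ⟨hpg, ⟨hc, hch⟩, he⟩
    have hp : p ∈ Q.points := (add_mem_points_iff Q hg p).1 hpg
    exact ⟨hp, ⟨fun h0 => hc ((isChargeFree_add_period (1 / 100) Q hg hp hpg).2 h0),
      fun h0 => hch ((chartedAt_add_period θ Q hg hp hpg).2 h0)⟩, he⟩
  · rintro ⟨hp, ⟨hc, hch⟩, he⟩
    have hpg : p + g ∈ Q.points := Q.add_mem_points hp hg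
    exact ⟨hpg, ⟨fun h0 => hc ((isChargeFree_add_period (1 / 100) Q hg hp hpg).1 h0),
      fun h0 => hch ((chartedAt_add_period θ Q hg hp hpg).1 h0)⟩, he⟩

/-- ★ The compact gross charged species only reads the point set: two presentations of one point set have the same species. -/
theorem compactGrossAt_congr_points (θ ε R : ℝ) {P Q : PeriodicConfiguration 3} (h : P.points = Q.points) (p : E3) :
    CompactGrossAt θ ε R P p ↔ CompactGrossAt θ ε R Q p := by
  simp only [CompactGrossAt, ExposedAt, ChartedAt, shellSet, nn, siteEnergy, IsHole, holeField]
  rw [h]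

end Summit.AtomisticToContinuum.Crystallization.Theorems.ChargedEnergyGapChartDial

end
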